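import Literature.NumberTheory.Automorphic.IdeleClassCharacterConjugate
import Literature.NumberTheory.ComplexMultiplication.ReflexOfConjugateType
import HarnessLib

/-!
# [Liu2021] Remark 4.4, reflex half: `M'_{μ^c} = M'_μ` and `Ψ_{μ^c}` is the opposite CM type of `Ψ_μ`

Topic `NumberTheory/Automorphic`; namespace `Literature.NumberTheory.Automorphic.IdeleClassGroup`.  Companion of
`IdeleClassCharacterConjugate` (`μ^c = galConj c μ`; **`Φ_{μ^c} = \bar Φ_μ`**, `IsConjugateSymplectic.cmType_galConj`,
`HasCMType.galConj_complexConj`), whose module docstring lists the statements below under "NOT HERE", and of the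
generic CM-type file `ComplexMultiplication/ReflexOfConjugateType` (`traceField_bar`, `reflexField_algValuedIn_bar`,
`reflexCMType_bar`), of which they are the character-level instances.

SOURCE / AS PRINTED.  Y. Liu, *Fourier–Jacobi cycles and arithmetic relative trace formula*, Camb. J. Math. 9
(2021) = arXiv:2102.11518 [Liu2021], §4.1, author's TeX `FJcycle.tex` (md5 `6db49a74122d…`; held extraction
`paper:arxiv-2102.11518`, chunk p0018):
* Definition 4.3 (2) (TeX l. 1921; p0018 L41): "If `w_μ` does not contain zero, then we call `Φ_μ` the *CM type*
  of `μ`. Furthermore, we denote by `M'_μ ⊆ ℂ` the reflex field of `(E, Φ_μ)`, with the induced CM type `Ψ_μ`."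
* **Remark 4.4** (TeX ll. 1930–1933; p0018 L50–51): "It is clear that `μ^c` is conjugate symplectic of the same
  weight as `μ`. Moreover, we have `M_{μ^c} = M_μ`, `M'_{μ^c} = M'_μ`, and that `Ψ_{μ^c}` is the opposite CM
  type of `Ψ_μ`."

DICTIONARY.  `L` = Liu's CM field `E`; `ψ : C_L →ₜ* S¹` a continuous unitary idele class character (Liu's
`μ`); `galConj c ψ` = `μ^c` (`c = IsCMField.complexConj L`); `hψ.cmType : CMType L` = `Φ_μ` (Def. 4.3 (2), for
conjugate symplectic `ψ`, `ConjugateSelfDualInfinityType` § 5) and `HasCMType L ψ Φ` its relational form;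
Liu's **`M'_μ ⊆ ℂ`** = `traceField Φ_μ = ℚ(tr_{Φ_μ}(x) | x ∈ L) ⊆ ℂ` (`ComplexReflexField`: Shimura 1998 §8.3
Prop. 28 "`K* = ℚ(∑ᵢ ξ^{φᵢ})`", equal to `ι(K*_{L'})` for every Galois `L'` receiving `L`,
`map_reflexField_algValuedIn`); inside an auxiliary field `L'` (via `φ : L →ₐ[ℚ] L'`, `ι : L' →+* ℂ`) the reflex
field is `reflexField ℚ L' (algValuedIn ι Φ)` and **`Ψ_μ`** = `reflexCMType ι Φ_μ φ` (`ReflexCMType`), a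
complex CM type of that reflex field; "opposite CM type" = `CMTypeOps.bar`.

WHAT IS HERE (all PROVED; theorems only, no definitions, no named facts — D-0026):
* `HasCMType.traceField_eq_of_galConj`, **`IsConjugateSymplectic.traceField_cmType_galConj`** —
  **`M'_{μ^c} = M'_μ`** as subfields of `ℂ` (no auxiliary field);
* `HasCMType.reflexField_eq_of_galConj`, `IsConjugateSymplectic.reflexField_cmType_galConj` — the same read in
  any field `L'` of characteristic zero receiving `L`;
* `HasCMType.reflexCMType_eq_of_galConj`, **`IsConjugateSymplectic.reflexCMType_cmType_galConj`** —
  **`Ψ_{μ^c} = \bar Ψ_μ`**: the reflex CM type of `Φ_{μ^c}` is the conjugate of that of `Φ_μ`, transported along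
  the identification of the two (equal) reflex fields (`inducedCMType` along `IntermediateField.equivOfEq`);
* `IsConjugateSymplectic.remark44_reflex` — the two clauses assembled next to `IsConjugateSymplectic.remark44`.

NOT HERE: `M_{μ^c} = M_μ` and `M_μ ⊇ M'_μ` (the field of values of `μ^{alg}`;
`IdeleClassCharacterAlgebraicTwist.muAlgValueField_galConj` has the first).

## References

* [Liu2021] Y. Liu, *Fourier–Jacobi cycles and arithmetic relative trace formula* (appendix by C. Li and
  Y. Zhu), Camb. J. Math. 9 (2021), no. 1, 1–147, arXiv:2102.11518 — §4.1 Def. 4.3 (2), Remark 4.4.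
* [Shimura1998] G. Shimura, *Abelian Varieties with Complex Multiplication and Modular Functions* (1998), §8.3
  Prop. 28.

## Provenance

pub-hodgecm2 (COR-CM) literature seat `lit-liu-1` gen 4, «Liu 2021 inputs» (row L4 of the cell's
`lit/LIU2021.md`).
-/

set_option autoImplicit false

-- `open` at top level: inside `namespace Literature.NumberTheory.Automorphic…` the name `NumberField` resolves to a
-- tree namespace first (lean/CONVENTIONS.md §2), so Mathlib's `NumberField` is opened here.
open NumberField
open Literature.AlgebraicGeometry.Motives (CMType)
open Literature.NumberTheory.ComplexMultiplication
open Literature.NumberTheory.ComplexMultiplication.CMTypeOps (bar)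

namespace Literature.NumberTheory.Automorphic.IdeleClassGroup

variable {L : Type} [Field L] [NumberField L] [IsCMField L]

local notation3 "𝔠" => IsCMField.complexConj L

/-! ### `M'_{μ^c} = M'_μ` inside `ℂ` -/

/-- **`M'_{μ^c} = M'_μ` (⊆ ℂ)**, relational form: if `μ` has CM type `Φ` and `μ^c` has CM type `Φ'` (necessarily
`Φ' = \bar Φ`, `HasCMType.galConj_complexConj` + uniqueness), then the complex reflex fields
`ℚ(tr_{Φ'}(L)) = ℚ(tr_Φ(L)) ⊆ ℂ` coincide. [cite: Liu2021, Remark 4.4 (TeX ll. 1930–1933)] -/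
theorem HasCMType.traceField_eq_of_galConj {ψ : IdeleClassGroup L →ₜ* Circle} {Φ Φ' : CMType L}
    (hΦ : HasCMType L ψ Φ) (hΦ' : HasCMType L (galConj 𝔠 ψ) Φ') : traceField Φ' = traceField Φ := by
  rw [HasCMType.unique hΦ' hΦ.galConj_complexConj, traceField_bar]

/-- **[Liu2021, Remark 4.4]: `M'_{μ^c} = M'_μ`** — for a conjugate symplectic `μ`, the reflex field
`M'_μ ⊆ ℂ` of `(E, Φ_μ)` (`traceField`, Shimura's `ℚ(∑ᵢ ξ^{φᵢ})`) equals that of `(E, Φ_{μ^c}) = (E, \bar Φ_μ)`.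
[cite: Liu2021, Remark 4.4 (TeX ll. 1930–1933)] -/
theorem IsConjugateSymplectic.traceField_cmType_galConj {ψ : IdeleClassGroup L →ₜ* Circle}
    (hψ : IsConjugateSymplectic L ψ) : traceField hψ.galConj.cmType = traceField hψ.cmType := by
  rw [hψ.cmType_galConj, traceField_bar]

/-! ### `M'_{μ^c} = M'_μ` read in an auxiliary field `L'` -/

section InField

variable {L' : Type*} [Field L'] [CharZero L']

/-- `M'_{μ^c} = M'_μ` read in any field `L'` of characteristic zero through `ι : L' → ℂ`: the Galois-side reflex
fields `reflexField ℚ L' (Φ'_{L'})` and `reflexField ℚ L' (Φ_{L'})` coincide. [cite: Liu2021, Remark 4.4 (TeX ll. 1930–1933)] -/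
theorem HasCMType.reflexField_eq_of_galConj {ψ : IdeleClassGroup L →ₜ* Circle} {Φ Φ' : CMType L}
    (hΦ : HasCMType L ψ Φ) (hΦ' : HasCMType L (galConj 𝔠 ψ) Φ') (ι : L' →+* ℂ) :
    reflexField ℚ L' (algValuedIn ι Φ'.1) = reflexField ℚ L' (algValuedIn ι Φ.1) := by
  rw [HasCMType.unique hΦ' hΦ.galConj_complexConj, reflexField_algValuedIn_bar]

/-- `M'_{μ^c} = M'_μ` read in `L'`, for the function `cmType`. [cite: Liu2021, Remark 4.4 (TeX ll. 1930–1933)] -/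
theorem IsConjugateSymplectic.reflexField_cmType_galConj {ψ : IdeleClassGroup L →ₜ* Circle}
    (hψ : IsConjugateSymplectic L ψ) (ι : L' →+* ℂ) :
    reflexField ℚ L' (algValuedIn ι hψ.galConj.cmType.1) = reflexField ℚ L' (algValuedIn ι hψ.cmType.1) := by
  rw [hψ.cmType_galConj, reflexField_algValuedIn_bar]

end InField

/-! ### `Ψ_{μ^c}` is the opposite CM type of `Ψ_μ` -/

section ReflexType

variable {L' : Type*} [Field L'] [NumberField L'] [IsCMField L'] [Normal ℚ L']

/-- **`Ψ_{μ^c} = \bar Ψ_μ`**, relational form: if `μ` has CM type `Φ` and `μ^c` has CM type `Φ'`, then — inside a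
CM field `L'` normal over `ℚ` receiving `L` via `φ`, read in `ℂ` via `ι` — the reflex CM type of `Φ'` is the
CONJUGATE of the reflex CM type of `Φ`, transported along the identification of the two equal reflex fields.
[cite: Liu2021, Remark 4.4 (TeX ll. 1930–1933)] -/
theorem HasCMType.reflexCMType_eq_of_galConj {ψ : IdeleClassGroup L →ₜ* Circle} {Φ Φ' : CMType L}
    (hΦ : HasCMType L ψ Φ) (hΦ' : HasCMType L (galConj 𝔠 ψ) Φ') (ι : L' →+* ℂ) (φ : L →ₐ[ℚ] L') :
    reflexCMType ι Φ' φ =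
      inducedCMType
        ((IntermediateField.equivOfEq (hΦ.reflexField_eq_of_galConj hΦ' ι).symm :
            reflexField ℚ L' (algValuedIn ι Φ.1) ≃ₐ[ℚ] reflexField ℚ L' (algValuedIn ι Φ'.1)) :
          reflexField ℚ L' (algValuedIn ι Φ.1) →+* reflexField ℚ L' (algValuedIn ι Φ'.1))
        (bar (reflexCMType ι Φ φ)) := by
  obtain rfl : Φ' = bar Φ := HasCMType.unique hΦ' hΦ.galConj_complexConj
  exact reflexCMType_bar ι Φ φ

/-- **[Liu2021, Remark 4.4]: "`Ψ_{μ^c}` is the opposite CM type of `Ψ_μ`"** — for a conjugate symplectic `μ`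
with CM type `Φ_μ = hψ.cmType` (so `Φ_{μ^c} = \bar Φ_μ`, `cmType_galConj`): the reflex CM type `Ψ_{μ^c}` of
`(E, Φ_{μ^c})` is the conjugate `\bar Ψ_μ` of the reflex CM type of `(E, Φ_μ)`, as CM types of the common reflex
field `M'_{μ^c} = M'_μ` (transport along `IntermediateField.equivOfEq`). [cite: Liu2021, Remark 4.4 (TeX ll. 1930–1933)] -/
theorem IsConjugateSymplectic.reflexCMType_cmType_galConj {ψ : IdeleClassGroup L →ₜ* Circle}
    (hψ : IsConjugateSymplectic L ψ) (ι : L' →+* ℂ) (φ : L →ₐ[ℚ] L') :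
    reflexCMType ι hψ.galConj.cmType φ =
      inducedCMType
        ((IntermediateField.equivOfEq (hψ.reflexField_cmType_galConj ι).symm :
            reflexField ℚ L' (algValuedIn ι hψ.cmType.1) ≃ₐ[ℚ]
              reflexField ℚ L' (algValuedIn ι hψ.galConj.cmType.1)) :
          reflexField ℚ L' (algValuedIn ι hψ.cmType.1) →+* reflexField ℚ L' (algValuedIn ι hψ.galConj.cmType.1))
        (bar (reflexCMType ι hψ.cmType φ)) :=
  hψ.hasCMType_cmType.reflexCMType_eq_of_galConj hψ.galConj.hasCMType_cmType ι φ

/-- **[Liu2021, Remark 4.4], reflex half, assembled** (next to `IsConjugateSymplectic.remark44`): for a conjugate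
symplectic `μ`, `M'_{μ^c} = M'_μ ⊆ ℂ`, and for every complex embedding `τ` of the common reflex field (read in a
Galois CM field `L'`), `τ ∈ Ψ_{μ^c} ↔ \bar τ ∈ Ψ_μ`. [cite: Liu2021, Remark 4.4 (TeX ll. 1930–1933)] -/
theorem IsConjugateSymplectic.remark44_reflex {ψ : IdeleClassGroup L →ₜ* Circle}
    (hψ : IsConjugateSymplectic L ψ) (ι : L' →+* ℂ) (φ : L →ₐ[ℚ] L') :
    traceField hψ.galConj.cmType = traceField hψ.cmType ∧
      ∀ τ : reflexField ℚ L' (algValuedIn ι hψ.galConj.cmType.1) →+* ℂ,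
        τ ∈ (reflexCMType ι hψ.galConj.cmType φ).1 ↔
          ComplexEmbedding.conjugate (τ.comp
            ((IntermediateField.equivOfEq (hψ.reflexField_cmType_galConj ι).symm :
                reflexField ℚ L' (algValuedIn ι hψ.cmType.1) ≃ₐ[ℚ]
                  reflexField ℚ L' (algValuedIn ι hψ.galConj.cmType.1)) :
              reflexField ℚ L' (algValuedIn ι hψ.cmType.1) →+*
                reflexField ℚ L' (algValuedIn ι hψ.galConj.cmType.1))) ∈ (reflexCMType ι hψ.cmType φ).1 := by
  refine ⟨hψ.traceField_cmType_galConj, fun τ => ?_⟩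
  rw [hψ.reflexCMType_cmType_galConj ι φ, mem_inducedCMType_iff, CMTypeOps.mem_bar_iff,
    CMTypeOps.conjugate_mem_iff_notMem]

end ReflexType

end Literature.NumberTheory.Automorphic.IdeleClassGroup
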